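import Mathlib
import HarnessLib
import HarnessLib.Audit
import Summits.KontsevichZagierPeriods.Statement
import Summits.KontsevichZagierPeriods.KontsevichZagierPeriods.Theorems.ExpConservativeKernelImpliesStatement

/-!
Route: VietaFibre

DORMANT since 2026-09-04T22:27:18Z (reconciler: no traction for 5 d (last activity statement-checked at 2026-08-30T21:48:23Z); parked, not closed — `ledger route dormant route-KontsevichZagierPeriods-VietaFibre --off` to reactivate) — unstaffed, not closed; items shared with open routes are served there. `ledger route dormant <id> --off` reactivates.

# Route VietaFibre — Vieta in the fibre — hyperbolic-layer relators as a fourth value-zero move;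
Newton, Arnold–Givental, Ivory and MacLaurin compiled into the rules

ENGINE + SECTOR route realising idea card principia-vieta-in-the-fibre-potentials (audited
new-combination). It suffices to show X := the
KERNEL FORM of Conjecture 1 (`Literature.NumberTheory.Transcendental.KZKernelConjecture`: every
formal ℤ-combination of integral
representations with value 0 lies in `KZ.relations`; PROVED equivalent to the summit in tree, the
implication being
Theorems/KernelFormKernelImpliesStatement). Declared up front: the cruxes are INSTANCES and DERIVED
RULES of X on the potential-theoretic
sector, not a decomposition of X. The route's content is a fourth value-zero mechanism of the fixed
calculus, VIETA IN THE FIBRE: when the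
last-coordinate fibres of a domain are the d intervals of a layer {c₁ ≤ φ(x,t) ≤ c₂} cut out by ONE
polynomial φ(x,·) hyperbolic at both
levels, and the integrand is sign(∂ₜφ)·∂ₜP with deg_t P ≤ d − 1, Newton–Leibniz on the d bands
leaves the base integrand
Σ_k P(x,β_k) − P(x,α_k) — a difference of power sums of the roots of φ − c₂ and φ − c₁, which share
every coefficient but the constant one —
hence 0 identically (Newton–Girard): the representation is a relation although NO band integral
vanishes, the body has NO symmetry and NO
closed form is written (crux HyperbolicLayerRelator). One signed-polar change of variables about a
rational point p turns the Newtonian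
force kernels (x_j − p_j)|x − p|^{−n}·w(x) into exactly this shape, so Newton's homoeoid theorem (d
= 2), Arnold's hyperbolic-layer theorem
and Givental's weighted version (deg w ≤ d − 2, all even d, all n) become move chains (crux
ArnoldForceVanishing; support PlanarHomoeoid is
the literal rational instance of the summit in the plane). Where hyperbolicity fails (exterior
points) Vieta is silent and identities go
through CORRESPONDENCES: Ivory's affine map compiles his 1809 theorem in four moves (support
IvoryCorresponding), and MacLaurin's theorem at
a generic rational exterior point (crux MacLaurinExterior: genus-1 × π values in dimension 3) is the
informative frontier item. Support
DepolarisationSum (A + B + C = 2, three elliptic integrals of the second kind, ONE Newton–Leibniz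
move with an algebraic primitive) is the
cheapest rational-valued genus-1 calibration in the tree.
Lean: `∀ c : Literature.NumberTheory.Transcendental.KZ.FormalRep,
Literature.NumberTheory.Transcendental.KZ.eval c = 0 → c ∈
Literature.NumberTheory.Transcendental.KZ.relations`
(item KernelForm; verbatim the definiens of
`Literature.NumberTheory.Transcendental.KZKernelConjecture`, stated inline since rev 2 so that the
conjecture is this route's own registered target and not a by-name Literature leaf in the cone)

## Assembly
The deciding theorem `closes : KernelForm → HyperbolicLayerRelator → ArnoldForceVanishing →
MacLaurinExterior → KontsevichZagierPeriods`
(rev 7, CRUX-ONLY per D-0027 §2.2, native-certified; revs 3–6 also listed the supports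
PlanarHomoeoid, IvoryCorresponding, DepolarisationSum as
binders — never used in the proof, they remain items of the route) proves the kernel step INLINE —
r.value = r'.value
⇒ KZ.eval ([r] − [r']) = 0 (map_sub, eval_of) ⇒ [r] − [r'] ∈ KZ.relations = KZ.Equivalent r r' — the
same three lines as
Theorems/KernelFormKernelImpliesStatement
(`Summit.KontsevichZagierPeriods.KernelForm.kontsevichZagierPeriods_of_kzKernelConjecture`), so only
KernelForm is load-bearing. KernelForm (shared item stmt-KontsevichZagierPeriods-10447 = the summit,
`kernelForm_iff_summit`) is HELD since
2026-08-16 (route-choice WAIT, rev 6): decided-by stmt-0541 ∧ stmt-5621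
(`kernelForm_iff_ayoubPiLocalKernel_and_positiveCancellation`,
Theorems/VietaFibreKernelFormItemDictionary) and would be refuted by a proof of stmt-11011
(`Neg.CancellationGap`); it is named so that `closes` reaches the Statement
honestly and is staffed once, as the shared item, never per sector route. The item `Assembly :=
KernelForm → KontsevichZagierPeriods` (rev 4, replacing the shared by-name item
stmt-KontsevichZagierPeriods-0197 for this route) records that step and is provable now. The cruxes
do not decompose the target:
HyperbolicLayerRelator, ArnoldForceVanishing, MacLaurinExterior and the three supports are instances
of KernelForm (a representation of value 0
is a relation; two representations with equal values are equivalent) — a sector route that says so,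
in the pattern of CompiledSubstitutions
and HyperbolicBloch.

Rationale: WHY THIS LINE. Mechanism: polar CoV (kernel × Jacobian = polynomial in r) + Newton–Leibniz on
root-function bands + pointwise Vieta/Newton–Girard on the
boundary sums — the elementary proof of Newton (Principia I Prop. LXX/XCI; Kellogg1967 p. 22 "equal
chords" = Vieta for a quadratic),
Arnold1985HyperbolicLayers, Givental1984, VainshteinShapiro1985 (statements in Arnold1989 App. 15
pp. 423–425) — transcribed into
Kontsevich–Zagier's rules (KontsevichZagierPeriods2001 §1.2), where it is a value-zero pattern the
tree does not have: GaussManin's KZStokes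
needs a primitive vanishing on the WHOLE fibre frontier (here only the SUM over the d fibre
components vanishes), symmetry moves need an
involution of the body (none for d ≥ 4), fibrewise-exact integrands vanish band by band (these do
not). Imported areas: classical potential
theory of ellipsoids (Ivory1809, Kellogg1967 Ch. VII §6 formulas (33)–(35)) and the real algebraic
geometry of hyperbolic polynomials /
Petrovsky–ABG lacunas (AtiyahBottGarding1970; the modern frontier AgranovskyEtAl2023,
KoldobskyMerkurjevYaskin2017, Agranovsky2022 marks
where fibre integrals stop being algebraic in the parameter). The primitive barrier (Ayoub2015 Rem.
1.2, CressonViusos2022 §2.1) is met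
head-on and evaded by design of the kernel: after the polar move the fibre primitive is a
POLYNOMIAL. Negatives index empty; no prior route
or refutation touches potentials, hyperbolic layers or cross-component cancellation.

RANKED CRUXES. #0 KernelForm (target) — the kernel form of Conjecture 1 — every formal ℤ-combination
of KZ integral representations with KZ.eval = 0 lies in KZ.relations (tree constant
KZKernelConjecture; ⇔ summit, proved in KZKernelConjectureForms /
Theorems/KernelFormKernelImpliesStatement). Every other item of this route is an instance
(value-zero representation, or pair with equal values) of it. (why it might fail: it IS Conjecture 1
in kernel form: the GPC-strength barriers (odd zeta, 2πi/log, elliptic periods) apply verbatim;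
false iff some vanishing combination — e.g. a potential identity at non-hyperbolic position — has no
move chain.) [KontsevichZagierPeriods2001, HuberMullerStachPeriods2017, CressonViusos2022]
#2 HyperbolicLayerRelator (crux) — ENGINE ("Vieta in the fibre", card steps (ii)+(iv), abstract
form). Base τ ⊆ ℝⁿ ℚ-semialgebraic; φ(x,t) = Σ_{i≤d} a_i(x)tⁱ with a_i ℚ-semialgebraic on τ;
rational levels c₁ < c₂; ℚ-semialgebraic root functions α_1 < … < α_d, β_1 < … < β_d on τ that are
EXACTLY the roots of φ(x,·) = c₁, resp. = c₂ (hyperbolicity at both levels, encoded as data — no CAD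
needed by the prover); P(x,t) = Σ_{k<d} q_k(x)tᵏ (deg_t P ≤ d − 1, q_k semialgebraic). Then every
representation r on the layer {(x,t) : x ∈ τ, c₁ ≤ φ ≤ c₂} with integrand sign(∂ₜφ)·∂ₜP satisfies
KZ.of r ∈ KZ.relations. Proof plan (all four moves, nothing else): on each fibre the layer is the
disjoint union of d intervals I_k with endpoints {α_k, β_k} (k-th root paired with k-th root; φ
monotone on I_k, ∂ₜφ ≠ 0 inside); split τ by the semialgebraic orientation pattern {α_k < β_k}/{β_k
< α_k} and the layer into the d bands (domain additivity, null overlaps); newtonLeibnizRel on each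
band with the polynomial-in-t primitive ±P (semialgebraic, continuous on the closed fibre); the d
base reps add up (integrand additivity) to [τ, Σ_k P(·,β_k) − P(·,α_k)], whose integrand is Σ_j
q_j·(p_j(β) − p_j(α)) = 0 pointwise by Newton–Girard (p_j, j ≤ d−1, depends on a_d,…,a_{d−j} only,
and φ − c₁, φ − c₂ differ in a_0 alone); a zero-integrand rep is a relation (z = z + z).
[difficulty: L] (why it might fail: as typed the k-th/k-th root pairing and the telescoping ε = sign
∂ₜφ must hold on EVERY fibre incl. odd d over a proper base and a_d of either sign; a fibre where φ'
vanishes inside a band or the pairing crosses would falsify it (hand-checked, numerics d = 4 only).)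
[Arnold1985HyperbolicLayers, VainshteinShapiro1985, Kellogg1967, KontsevichZagierPeriods2001,
BochnakCosteRoy1998]
#3 ArnoldForceVanishing (crux) — Newton–Arnold–Givental inside the rules (card P2/P3/P5 merged). F,
w ∈ ℚ[x₁..x_n], n ≥ 2, deg F ≤ d, deg w ≤ d − 2, rational p and levels c₁ < c₂ such that on EVERY
real line through p both F = c₁ and F = c₂ have d distinct roots (strict hyperbolicity; forces d
even, top form definite, compact ovaloids, F(p) ∉ [c₁,c₂]); ε(x) = sign((x − p)·∇F(x)) (never 0 on
the closed layer). Then the two halves r₁ = [layer ∩ {ε > 0}, w·(x_j − p_j)/|x − p|ⁿ] and r₂ =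
[layer ∩ {ε < 0}, same] are KZ-equivalent (their values agree because the signed force ∫ ε w k_j
vanishes: Newton d = 2, Arnold w = 1, Givental deg w ≤ d − 2; for n even both reps are RATIONAL —
literal summit instances). Plan: ONE change of variables, the signed polar chart (u, r) ↦ p +
r·v(u), u in the open unit ball of ℝⁿ⁻¹ (stereographic, v rational, v_n > 0), r ∈ ℝ∖{0}, injective
onto ℝⁿ minus a null hyperplane, Jacobian |r|ⁿ⁻¹J(u) rational: the pulled-back integrand is
sign(∂_rφ_u)·w(p + rv)·v_j(u)J(u), polynomial of degree ≤ d − 2 in r times the sign — exactly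
HyperbolicLayerRelator with P = ∫(…)dr of degree ≤ d − 1 over direction cells where the root
functions are continuous semialgebraic; plus null-set and orientation bookkeeping (domain
additivity, [σ,f] + [σ,−f] ~ 0). [deps: HyperbolicLayerRelator] [difficulty: XL] (why it might fail:
needs continuous semialgebraic root functions on finitely many direction cells (CAD with sections,
BochnakCosteRoy1998 Thm 2.3.1, not in tree) and HasFDerivWithinAt/InjOn of the stereographic polar
chart; the bound deg w ≤ d−2 is sharp (deg 3, d = 4 gives force 1.35 ≠ 0 numerically).)
[Arnold1985HyperbolicLayers, Givental1984, Arnold1989, VainshteinShapiro1985, Kellogg1967]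
#4 MacLaurinExterior (crux) — the FRONTIER item (card (c)/P4): non-hyperbolic position, where Vieta
is silent and identities must go through correspondences. Confocal rational solid ellipsoids E =
(a,b,c) ⊃ E′ = (a′,b′,c′) (a² − a′² = b² − b′² = c² − c′² > 0; e.g. (7, 11/2, 5) ⊃ (5, 5/2, 1)),
rational p exterior to E, j ∈ {0,1,2}: a′b′c′·[E, (x_j − p_j)/|x − p|³] ~ abc·[E′, (x_j − p_j)/|x −
p|³] (MacLaurin: confocal homogeneous ellipsoids attract exterior points in proportion to their
masses; both values = 2π·abc·a′b′c′·p_j·∫_λ^∞ ds/((a_j²+s)Δ(s)), incomplete elliptic × π; checked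
numerically to 1e−3). Foreseeable chain (≥ 10 moves, dimension ≤ 5): Ivory (IvoryCorresponding)
reduces to INTERIOR attraction of the confocal ellipsoid E_p through p at two different interior
points; interior linearity F_j(E;q) = −2π abc A_j q_j needs the s-unfolding 1/Q = ½∫₀^∞
s^{−1/2}(Q+s)^{−3/2}ds (ONE Newton–Leibniz, algebraic primitive 2√s/(Q√(Q+s))), the linear CoV x ↦
(A+s)^{−1/2}x uniform in the unfolded s, and polar Newton–Leibniz with primitive r³/3; E_p has
ALGEBRAIC (not rational) semi-axes — allowed. [difficulty: XL] (why it might fail: no Vieta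
cancellation at exterior p; if interior linearity (the A_j elliptic integrals × 2π) does not compile
through the s-unfolding, the only remaining proofs use ellipsoidal coordinates (3-sheeted
correspondence) or Dirichlet uniqueness — not moves — and this becomes a Neg candidate.) [Ivory1809,
Kellogg1967, Arnold1989, KontsevichZagierPeriods2001]
#9 PlanarHomoeoid (support) — Newton's no-attraction theorem in the plane as a LITERAL instance of
the summit between two RATIONAL representations: for the elliptic ring c₁ ≤ Ax² + By² ≤ c₂ (A, B,
c₁, c₂ ∈ ℚ₊) and a rational point p inside the inner ellipse, the logarithmic-force integrals of the
two halves {x₀ > p₀} (integrand (x_j − p_j)/|x − p|²) and {x₀ < p₀} (integrand −(x_j − p_j)/|x −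
p|²) are equal (total force 0; ε ≡ +1 for d = 2) hence KZ-equivalent. d = 2 case of
ArnoldForceVanishing: root functions explicit by the quadratic formula (no CAD), Kellogg's
equal-chords lemma; numerics (A,B,c₁,c₂,p) = (1,2,1,4,(1/2,1/3)): halves = ±(1.88700, −0.07456).
[difficulty: L] [Kellogg1967, KontsevichZagierPeriods2001, Arnold1985HyperbolicLayers]
#9 IvoryCorresponding (support) — Ivory's theorem (1809) at corresponding points, the ACCESSIBLE
exterior case, four moves: E ⊃ E′ confocal rational solid ellipsoids, P rational on ∂E, P′ =
(a′P₀/a, b′P₁/b, c′P₂/c) ∈ ∂E′; then b′c′·[E, (x₀ − P′₀)/|x − P′|³] ~ bc·[E′, (x₀ − P₀)/|x − P|³]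
(values −2π·a′bc·b′c′·A₁·P₀ both; checked). Chain: Newton–Leibniz along x₀ (primitive 1/|x − P′|,
one null fibre through the interior point P′ excised) → base rep on the disc D_E with integrand
1/|Q₊ − P′| − 1/|Q₋ − P′| (Q± the fibre ends on ∂E) → Ivory's pointwise lemma |Q − ΦP| = |ΦQ − P|
for P, Q ∈ ∂E (pure algebra, EqOn) → affine CoV (y,z) ↦ (b′y/b, c′z/c) onto D_{E′}, constant
Jacobian b′c′/(bc) → Newton–Leibniz back up along x₀ on E′ (P exterior to E′: primitive continuous).
[difficulty: M] [Ivory1809, Arnold1989, Kellogg1967]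
#9 DepolarisationSum (support) — card P1, the "Poisson move": for rational a, b, c > 0 the
depolarisation factors A = abc∫₀^∞ ds/((a²+s)Δ), B, C (Δ = √((a²+s)(b²+s)(c²+s)); incomplete
elliptic integrals of the second kind) satisfy A + B + C = 2, as KZ.Equivalent of the compactified
(s = t/(1−t)) 1-dim algebraic rep [(0,1), abc·√(1−t)/√R(t)·Σ_i 1/(a_i²(1−t)+t)], R(t) =
Π_i(a_i²(1−t)+t), and the constant 2 (dim 0). ONE newtonLeibnizRel (base = point, band [0,1],
primitive Ψ(t) = −2abc(1−t)^{3/2}/√R(t), continuous on [0,1], Ψ(0) = −2, Ψ(1) = 0, Ψ′ = integrand on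
(0,1) — verified numerically at (1,2,3): A,B,C = 1.15309, 0.53431, 0.31260) plus dimension
bookkeeping (KZ.slab / IntegralRep 0 conventions). Cheapest rational-valued genus-1 calibration in
the tree (Gauss's flux theorem read on the ellipsoid; Kellogg1967 Ch. VII §6 Ex. 3). [difficulty:
provable-now] [Kellogg1967, KontsevichZagierPeriods2001]

TWO-LAYER PLAN. Foreseen glued splits (none filed now): ArnoldForceVanishing ⇐ SignedPolarChart (the
stereographic signed-polar CoV as one changeOfVariablesRel
instance off a null set) → DirectionCells (continuous semialgebraic root functions of φ_u = c on
finitely many cells) → ArnoldForceVanishing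
(glue = HyperbolicLayerRelator on each cell + additivity). MacLaurinExterior ⇐ IvoryCorresponding
(support, exists) → InteriorLinearity
([E, k_j(·,q)] ~ 2π·abc·A_j·q_j as a product rep, via the s-unfolding) → MacLaurinExterior.
HyperbolicLayerRelator ⇐ SingleBandTrace (one band,
NL with polynomial primitive) → NewtonGirardPointwise (the base-integrand identity) →
HyperbolicLayerRelator.

KILL CRITERIA. HyperbolicLayerRelator refuted AS TYPED (a fibre where the pairing/telescoping fails)
⇒ restate once with the missing hypothesis (route edit
--restate); refuted IN SUBSTANCE (a hyperbolic-layer relator of value 0 that is provably not in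
KZ.relations) ⇒ close `refuted:HyperbolicLayerRelator`
and hand the witness to route Neg — it would be the first concrete non-derivable identity.
ArnoldForceVanishing refuted with the engine intact
⇒ the polar chart / cell bookkeeping is wrong: pivot to an explicit cell list (d = 2, 4 first).
MacLaurinExterior refuted ⇒ not a kill: it
confirms the card's frontier prediction (non-hyperbolic position needs correspondences the four
moves lack) and is filed to Neg; the route keeps
the hyperbolic sector. KernelForm refuted ⇒ summit false (all positive routes close).
ArnoldForceVanishing proved elsewhere by a general
Stokes engine (GaussManin KZStokes made cross-component) ⇒ route superseded.

NOT DECOMPOSED YET. The signed-polar chart lemma and the direction-cell decomposition (children of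
ArnoldForceVanishing); the interior-linearity chain and the
solid-angle identity ∫_{S²}(vᵀBv)^{−3/2}dΩ = 4π/√det B by a linear CoV uniform in the unfolded
parameter (children of MacLaurinExterior); the
odd-d / proper-base variants of the engine; higher moments (Givental: deg w = d − 2 + r ⇒ interior
potential a harmonic polynomial of degree r,
a UNIFORM-in-p chain family — card P5) and the magnetic (Biot–Savart) analogues of Arnold1989 App.
15; Vassiliev's Lemma-XXVIII monodromy as
the parametric obstruction (card (c)) — all layer-2 or later, after crux 2 or 3 closes.

CHEAPEST FALSIFIER. Run the signed-force numerics for a non-symmetric strictly hyperbolic quartic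
layer in the plane with an off-centre p (DONE this session,
folder checks/check_vieta.py: F = (x²+2y²−1)((x−0.2)²/4+(y+0.1)²/8−1), levels ∓0.15, p = (0.1,0.05);
all 360 test lines have 4+4 roots;
signed force = (9e−5, −6e−5) for w = 1 and ≤ 1.4e−3 for two quadratic weights against an unsigned
scale ≈ 1–3, but (1.347, −4e−4) for
w = x³ — vanishing exactly up to deg w = d − 2 as claimed). Next cheapest: a prover closes
DepolarisationSum (one move) and PlanarHomoeoid
(d = 2, explicit roots) — if the d = 2 planar chain cannot be written with finitely many injective
semialgebraic charts, the whole line is dead.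
Lookup falsifier for novelty: zbMATH review of Arnold1985HyperbolicLayers (zbl 0597.70007) — the
proof IS line-pairing + Vieta (known; the
claimed delta is the transcription into the rules, not the cancellation).

NUMBERS. Checks run this session (pure-python quadrature, folder checks/): (A) planar quartic layer,
signed force (w=1) = (+9e−5, −6e−5), (w = x+2y−xy)
= (4.4e−4, 1.2e−4), (w = y²+3x) = (1.4e−3, 5e−4), (w = x³) = (1.347, −4.5e−4), (w = xy²) = (0.431,
−3e−4); grid h = 0.0046. (B) elliptic ring
x²+2y² ∈ [1,4], p = (1/2,1/3): total force (−8e−5, 7e−5), min (x−p)·∇F on the ring 0.626 > 0, halves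
±(1.88700, −0.07456). (C) A,B,C at
(a,b,c) = (1,2,3): 1.15309 + 0.53431 + 0.31260 = 2.000000; Ψ(0) = −2, Ψ(1⁻) = 0, Ψ′ = integrand at t
= 0.1, 0.5, 0.9. (D) MacLaurin, E = (7,5.5,5),
E′ = (5,2.5,1), p = (8,3,−2): a′b′c′F(E;p) = (−131.30, −57.74, 40.53) vs abc F(E′;p) = (−131.30,
−57.73, 40.53); closed form (Kellogg (33))
−131.32, −57.74, 40.53; λ_E′ − λ_E = 24.000. (E) Ivory corresponding points on the same pair: closed
forms b′c′F₁(E;P′) = bcF₁(E′;P) = −20.4088,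
grid N = 160: −20.59 vs −20.41 (interior singularity, slow convergence). Items at open: 8 (1 target,
3 cruxes, 3 support, 1 assembly).

DEFINITION REQUESTS. None: every item is typed over KZ.IntegralRep / KZ.relations / KZ.Equivalent,
MvPolynomial and Real.sign / Real.sqrt (Sketch.lean rc 0).
Bib entries added this session: Arnold1985HyperbolicLayers, Givental1984, Ivory1809,
VainshteinShapiro1985, Kellogg1967, Agranovsky2022,
KoldobskyMerkurjevYaskin2017, AgranovskyEtAl2023, AtiyahBottGarding1970.

Novelty: Searches (2026-08-15, 11:15–11:40Z): `lit search --hybrid "Newtonian potential hyperbolic layers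
Arnold attract"` (15 book hits; only
Arnold1989 relevant: App. 15 pp. 423–425 read); `lit galaxy search "Newtonian potential of
hyperbolic layers" --star all` (1 hit, panama =
Arnold1989; pdf/crabby stars timed out); `lit search --source zbmath "Arnold hyperbolic layers"` (6;
zbl 0597.70007 = Arnold1985HyperbolicLayers,
review read); zbMATH "polynomially integrable convex bodies" (5: KoldobskyMerkurjevYaskin2017
arXiv:1702.00429, Agranovsky2022,
AgranovskyEtAl2023 arXiv:2212.07510 — pp. 1–5 read: Newton's Lemma XXVIII, Arnold's problems
1987-14, Vassiliev Thm 2.1, lacunas Rem. 2.7);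
zbMATH "algebraically integrable bodies Vassiliev Newton lemma" (1); OpenAlex/S2 429 (budget
exhausted, recorded); `lit frontier
KontsevichZagierPeriods --since 2020` (30 rows, none on potentials/hyperbolic polynomials); `lit
bridges KontsevichZagierPeriods --cross any`
(30, none); held texts Kellogg1967 (pp. 22, 192–195 read) and Routh (no hits); the card's own audit
greps of KontsevichZagierPeriods2001 (no
potential/Newton/Ivory). Hub: 123 KontsevichZagierPeriods cards and 20 route files grep'd for
potential/homoeoid/hyperbolic layer/Vieta/Ivory —
only this card; nearest hub mechanisms integral-geometry-kinematic-formulas-compile (Crofton,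
motion-group incidence integrals) and
GaussManinCertificates.KZStokes (frontier-vanishing primitive) are different.
Nearest prior art found: Arnold1985HyperbolicLa  [refs: 10.1007/BF01086020, 10.1007/BF02394570, 1702.00429, 2212.07510, doi:10.1007/BF01086020, doi:10.1007/BF02394570, Arnold1989, KoldobskyMerkurjevYaskin2017, Agranovsky2022, AgranovskyEtAl2023, Kellogg1967, KontsevichZagierPeriods2001, VainshteinShapiro1985, Givental1984, AtiyahBottGarding1970]

Barriers (technique_class: fibrewise-newton-leibniz, vieta-trace, polar-chart): - technique_class: fibrewise-newton-leibniz, vieta-trace, polar-chart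
- Literature.Barriers.KontsevichZagierPeriods.noSemialgebraicPrimitive_inv_sub_two: met head-on and
evaded BY DESIGN OF THE KERNEL — the barrier kills fibrewise Newton–Leibniz for a generic algebraic
integrand (no semialgebraic primitive); after the signed-polar move the physical kernels (x_j −
p_j)|x−p|^{−n}·w become POLYNOMIAL in the fibre variable r, whose primitives are polynomial; the
route's scope is exactly the class where this happens and MacLaurinExterior marks where it stops.
- Literature.Barriers.KontsevichZagierPeriods.kzConjecture_implies_oddZetaAlgIndep: applies verbatim
to the target KernelForm only (admitted summit-strength); the cruxes assert derivability of
identities already known to hold (values 0 or equal by classical theorems) and prove no number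
transcendental.
- Literature.Barriers.KontsevichZagierPeriods.kzConjecture_implies_twoPiI_log_algIndep: same —
inherited by KernelForm only.
- Literature.Barriers.KontsevichZagierPeriods.kzConjecture_implies_ellipticPeriods_algIndep: same —
DepolarisationSum and MacLaurinExterior are LINEAR identities among (incomplete) elliptic integrals
with algebraic data, no algebraic independence is touched.
- Literature.Barriers.KontsevichZagierPeriods.cressonViuSos_prop_3_2: not engaged — no global
semialgebraic homeomorphism between domains is claimed; the chains use dissection, one polar chart
off a null set and dimension change.
- Literature.Barriers

History (route lifecycle, newest last):
- 2026-08-15T16:15:55Z · rev 2: restated KernelForm (stmt-KontsevichZagierPeriods-5147) — route-repair (re-route around undeclared-conjecture): KernelForm restated 1:1 as the verbatim definiens of KZKernelConjecture (∀ c, KZ.eval c = 0 → c ∈ KZ.relat (planner-rbadge-KontsevichZagierPeriods-VietaFi-3bc5a176-g2-0)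
- 2026-08-15T16:17:20Z · rev 4: restated Assembly (stmt-KontsevichZagierPeriods-0197) — route-repair (re-route around undeclared-conjecture, last step): Assembly restated for this route as KernelForm → KontsevichZagierPeriods over the route's own i (planner-rbadge-KontsevichZagierPeriods-VietaFi-3bc5a176-g2-0)
- 2026-08-16T04:09:53Z · AUTO-CRUX (backfill): KernelForm — hypotheses of the deciding theorem that nothing in the route derives are cruxes (operator:999:1085951)
- 2026-08-23T22:03:08Z · DORMANT — reconciler: no traction for 6.3 d (last activity item-evidence-added at 2026-08-17T14:41:05Z); parked, not closed — `ledger route dormant route-KontsevichZagier (operator:999:1336383)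
- 2026-08-30T03:41:37Z · REACTIVATED — reconciler: reactivated — activity statement-attached at 2026-08-30T02:51:58Z after parking at 2026-08-23T22:03:08Z (operator:999:13204)
- 2026-09-04T22:27:18Z · DORMANT — reconciler: no traction for 5 d (last activity statement-checked at 2026-08-30T21:48:23Z); parked, not closed — `ledger route dormant route-KontsevichZagierPeri (operator:999:1112782)

sub-problem: KontsevichZagierPeriods · status: dormant · opened planner-plancard-KontsevichZagierPeriods-Kont-ef884a1d-0 2026-08-15T11:40:10Z · rev 10 · ledger route-KontsevichZagierPeriods-VietaFibre
GENERATED by the gate from the ledger (D-0016/17). Provers cite these decls: `theorem foo : Summit.KontsevichZagierPeriods.KontsevichZagierPeriods.Theses.VietaFibre.<Decl> := …` in Summits/KontsevichZagierPeriods/KontsevichZagierPeriods/Theorems/<Name>.lean.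
-/

namespace Summit.KontsevichZagierPeriods.KontsevichZagierPeriods.Theses.VietaFibre

open scoped BigOperators Topology Manifold Classical MeasureTheory ProbabilityTheory Matrix InnerProductSpace ComplexConjugate ContinuousMap
open Filter Set Function TopologicalSpace MeasureTheory

attribute [summit_statement] _root_.KontsevichZagierPeriods

open Literature Periods

-- earlier KernelForm (stmt-KontsevichZagierPeriods-5147, replaced 2026-08-15T16:15:55Z -> stmt-KontsevichZagierPeriods-10447): retired by None — Literature.NumberTheory.Transcendental.KZKernelConjecture
/-- item stmt-KontsevichZagierPeriods-10447 · crux (kind.auto-crux: conjecture-grade) · rank 0 · open · by planner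
why it might fail: it IS Conjecture 1 in kernel form: the GPC-strength barriers (odd zeta, 2πi/log, elliptic periods) apply verbatim; false iff some vanishing combination — e.g. a potential identity at non-hyperbolic position — has no move chain.
sources: KontsevichZagierPeriods2001, HuberMullerStachPeriods2017, CressonViusos2022
[target] the kernel form of Conjecture 1, stated INLINE over the calculus (verbatim the definiens of
`Literature.NumberTheory.Transcendental.KZKernelConjecture`, so the conjecture is this route's own
registered obligation rather than a by-name Literature leaf): every formal ℤ-combination c of KZ
integral representations with KZ.eval c = 0 lies in KZ.relations. ⇔ the summit
(kzKernelConjecture_iff_isRational in KZKernelConjectureForms; the implication used by `closes` is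
the 3-line kernel step r.value = r'.value ⇒ eval([r] − [r']) = 0 ⇒ [r] − [r'] ∈ relations, formerly
the shared Assembly item stmt-KontsevichZagierPeriods-0197, now proved inside `closes`). Every other
item of this route is an instance (value-zero representation, or pair with equal values) of it.
[difficulty: open-problem] -/
@[route_item "route-KontsevichZagierPeriods-VietaFibre"]
def KernelForm : Prop :=
  ∀ c : Literature.NumberTheory.Transcendental.KZ.FormalRep, Literature.NumberTheory.Transcendental.KZ.eval c = 0 → c ∈ Literature.NumberTheory.Transcendental.KZ.relations

/-- item stmt-KontsevichZagierPeriods-5148 · aside · rank 2 · open · by planner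
why it might fail: as typed the k-th/k-th root pairing and the telescoping ε = sign ∂ₜφ must hold on EVERY fibre incl. odd d over a proper base and a_d of either sign; a fibre where φ' vanishes inside a band or the pairing crosses would falsify it (hand-checked, numerics d = 4 only).
sources: Arnold1985HyperbolicLayers, VainshteinShapiro1985, Kellogg1967, KontsevichZagierPeriods2001, BochnakCosteRoy1998
[crux] ENGINE ("Vieta in the fibre", card steps (ii)+(iv), abstract form). Base τ ⊆ ℝⁿ
ℚ-semialgebraic; φ(x,t) = Σ_{i≤d} a_i(x)tⁱ with a_i ℚ-semialgebraic on τ; rational levels c₁ < c₂;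
ℚ-semialgebraic root functions α_1 < … < α_d, β_1 < … < β_d on τ that are EXACTLY the roots of
φ(x,·) = c₁, resp. = c₂ (hyperbolicity at both levels, encoded as data — no CAD needed by the
prover); P(x,t) = Σ_{k<d} q_k(x)tᵏ (deg_t P ≤ d − 1, q_k semialgebraic). Then every representation r
on the layer {(x,t) : x ∈ τ, c₁ ≤ φ ≤ c₂} with integrand sign(∂ₜφ)·∂ₜP satisfies KZ.of r ∈
KZ.relations. Proof plan (all four moves, nothing else): on each fibre the layer is the disjoint
union of d intervals I_k with endpoints {α_k, β_k} (k-th root paired with k-th root; φ monotone on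
I_k, ∂ₜφ ≠ 0 inside); split τ by the semialgebraic orientation pattern {α_k < β_k}/{β_k < α_k} and
the layer into the d bands (domain additivity, null overlaps); newtonLeibnizRel on each band with
the polynomial-in-t primitive ±P (semialgebraic, continuous on the closed fibre); the d base reps
add up (integrand additivity) to [τ, Σ_k P(·,β_k) − P(·,α_k)], whose integrand is Σ_j q_j·(p_j(β) −
p_j(α)) = 0 pointwise by Newton–Girard (p_ -/
@[route_item "route-KontsevichZagierPeriods-VietaFibre"]
def HyperbolicLayerRelator : Prop :=
  ∀ (n d : ℕ) (τ : Set (Fin n → ℝ)) (a : Fin (d + 1) → (Fin n → ℝ) → ℝ) (α β q : Fin d → (Fin n → ℝ) → ℝ) (c₁ c₂ : ℚ) (r : Literature.NumberTheory.Transcendental.KZ.IntegralRep (n + 1)), Literature.ModelTheory.ExponentialFields.IsSemialgebraic ℚ τ → (∀ i, Literature.NumberTheory.Transcendental.IsSemialgebraicFunOn ℚ τ (a i)) → (∀ k, Literature.NumberTheory.Transcendental.IsSemialgebraicFunOn ℚ τ (α k) ∧ Literature.NumberTheory.Transcendental.IsSemialgebraicFunOn ℚ τ (β k) ∧ Literature.NumberTheory.Transcendental.IsSemialgebraicFunOn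 ℚ τ (q k)) → c₁ < c₂ → (∀ x ∈ τ, StrictMono (fun k => α k x) ∧ StrictMono (fun k => β k x)) → (∀ x ∈ τ, ∀ t : ℝ, (∑ i, a i x * t ^ (i : ℕ) = c₁ ↔ ∃ k, α k x = t) ∧ (∑ i, a i x * t ^ (i : ℕ) = c₂ ↔ ∃ k, β k x = t)) → r.domain = {z | (Fin.init z : Fin n → ℝ) ∈ τ ∧ (c₁ : ℝ) ≤ ∑ i, a i (Fin.init z) * z (Fin.last n) ^ (i : ℕ) ∧ ∑ i, a i (Fin.init z) * z (Fin.last n) ^ (i : ℕ) ≤ (c₂ : ℝ)} → Set.EqOn r.integrand (fun z => Real.sign (∑ i : Fin (d + 1), ((i : ℕ) : ℝ) * a i (Fin.init z) * z (Fin.last n) ^ ((i : ℕ) - 1)) * ∑ k : Fin d, ((k : ℕ) : ℝ) * q k (Fin.init z) * z (Fin.last n) ^ ((k : ℕ) - 1)) r.domain → Literature.NumberTheory.Transcendental.KZ.of r ∈ Literature.NumberTheory.Transcendental.KZ.relations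

/-- item stmt-KontsevichZagierPeriods-5149 · aside · rank 3 · open · by planner
why it might fail: needs continuous semialgebraic root functions on finitely many direction cells (CAD with sections, BochnakCosteRoy1998 Thm 2.3.1, not in tree) and HasFDerivWithinAt/InjOn of the stereographic polar chart; the bound deg w ≤ d−2 is sharp (deg 3, d = 4 gives force 1.35 ≠ 0 numerically).
sources: Arnold1985HyperbolicLayers, Givental1984, Arnold1989, VainshteinShapiro1985, Kellogg1967
[crux] Newton–Arnold–Givental inside the rules (card P2/P3/P5 merged). F, w ∈ ℚ[x₁..x_n], n ≥ 2, deg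
F ≤ d, deg w ≤ d − 2, rational p and levels c₁ < c₂ such that on EVERY real line through p both F =
c₁ and F = c₂ have d distinct roots (strict hyperbolicity; forces d even, top form definite, compact
ovaloids, F(p) ∉ [c₁,c₂]); ε(x) = sign((x − p)·∇F(x)) (never 0 on the closed layer). Then the two
halves r₁ = [layer ∩ {ε > 0}, w·(x_j − p_j)/|x − p|ⁿ] and r₂ = [layer ∩ {ε < 0}, same] are
KZ-equivalent (their values agree because the signed force ∫ ε w k_j vanishes: Newton d = 2, Arnold
w = 1, Givental deg w ≤ d − 2; for n even both reps are RATIONAL — literal summit instances). Plan: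
ONE change of variables, the signed polar chart (u, r) ↦ p + r·v(u), u in the open unit ball of ℝⁿ⁻¹
(stereographic, v rational, v_n > 0), r ∈ ℝ∖{0}, injective onto ℝⁿ minus a null hyperplane, Jacobian
|r|ⁿ⁻¹J(u) rational: the pulled-back integrand is sign(∂_rφ_u)·w(p + rv)·v_j(u)J(u), polynomial of
degree ≤ d − 2 in r times the sign — exactly HyperbolicLayerRelator with P = ∫(…)dr of degree ≤ d −
1 over direction cells where the root functions are continuous semialgebraic; plus null-set and
orientation -/
@[route_item "route-KontsevichZagierPeriods-VietaFibre"]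
def ArnoldForceVanishing : Prop :=
  ∀ (n d : ℕ) (F w : MvPolynomial (Fin n) ℚ) (p : Fin n → ℚ) (c₁ c₂ : ℚ) (j : Fin n) (r₁ r₂ : Literature.NumberTheory.Transcendental.KZ.IntegralRep n), 2 ≤ n → F.totalDegree ≤ d → w.totalDegree + 2 ≤ d → c₁ < c₂ → (∀ v : Fin n → ℝ, v ≠ 0 → (∃ s : Finset ℝ, s.card = d ∧ ∀ t : ℝ, MvPolynomial.aeval (fun i => (p i : ℝ) + t * v i) F = (c₁ : ℝ) ↔ t ∈ s) ∧ (∃ s : Finset ℝ, s.card = d ∧ ∀ t : ℝ, MvPolynomial.aeval (fun i => (p i : ℝ) + t * v i) F = (c₂ : ℝ) ↔ t ∈ s)) → (MvPolynomial.aeval (fun i => (p i : ℝ)) F < (c₁ : ℝ) ∨ (c₂ : ℝ) < MvPolynomial.aeval (fun i => (p i : ℝ)) F) → r₁.domain = {x | (c₁ : ℝ) ≤ MvPolynomial.aeval x F ∧ MvPolynomial.aeval x F ≤ (c₂ : ℝ) ∧ 0 < ∑ i, (x i - p i) * MvPolynomial.aeval x (MvPolynomial.pderiv i F)} → r₂.domain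 = {x | (c₁ : ℝ) ≤ MvPolynomial.aeval x F ∧ MvPolynomial.aeval x F ≤ (c₂ : ℝ) ∧ ∑ i, (x i - p i) * MvPolynomial.aeval x (MvPolynomial.pderiv i F) < 0} → Set.EqOn r₁.integrand (fun x => MvPolynomial.aeval x w * (x j - p j) / Real.sqrt (∑ i, (x i - p i) ^ 2) ^ n) r₁.domain → Set.EqOn r₂.integrand (fun x => MvPolynomial.aeval x w * (x j - p j) / Real.sqrt (∑ i, (x i - p i) ^ 2) ^ n) r₂.domain → Literature.NumberTheory.Transcendental.KZ.Equivalent r₁ r₂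

/-- item stmt-KontsevichZagierPeriods-5150 · aside · rank 4 · open · by planner
why it might fail: no Vieta cancellation at exterior p; if interior linearity (the A_j elliptic integrals × 2π) does not compile through the s-unfolding, the only remaining proofs use ellipsoidal coordinates (3-sheeted correspondence) or Dirichlet uniqueness — not moves — and this becomes a Neg candidate.
sources: Ivory1809, Kellogg1967, Arnold1989, KontsevichZagierPeriods2001
[crux] the FRONTIER item (card (c)/P4): non-hyperbolic position, where Vieta is silent and
identities must go through correspondences. Confocal rational solid ellipsoids E = (a,b,c) ⊃ E′ =
(a′,b′,c′) (a² − a′² = b² − b′² = c² − c′² > 0; e.g. (7, 11/2, 5) ⊃ (5, 5/2, 1)), rational p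
exterior to E, j ∈ {0,1,2}: a′b′c′·[E, (x_j − p_j)/|x − p|³] ~ abc·[E′, (x_j − p_j)/|x − p|³]
(MacLaurin: confocal homogeneous ellipsoids attract exterior points in proportion to their masses;
both values = 2π·abc·a′b′c′·p_j·∫_λ^∞ ds/((a_j²+s)Δ(s)), incomplete elliptic × π; checked
numerically to 1e−3). Foreseeable chain (≥ 10 moves, dimension ≤ 5): Ivory (IvoryCorresponding)
reduces to INTERIOR attraction of the confocal ellipsoid E_p through p at two different interior
points; interior linearity F_j(E;q) = −2π abc A_j q_j needs the s-unfolding 1/Q = ½∫₀^∞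
s^{−1/2}(Q+s)^{−3/2}ds (ONE Newton–Leibniz, algebraic primitive 2√s/(Q√(Q+s))), the linear CoV x ↦
(A+s)^{−1/2}x uniform in the unfolded s, and polar Newton–Leibniz with primitive r³/3; E_p has
ALGEBRAIC (not rational) semi-axes — allowed. [difficulty: XL] -/
@[route_item "route-KontsevichZagierPeriods-VietaFibre"]
def MacLaurinExterior : Prop :=
  ∀ (a b c a' b' c' : ℚ) (p : Fin 3 → ℚ) (j : Fin 3) (r r' : Literature.NumberTheory.Transcendental.KZ.IntegralRep 3), 0 < a' → 0 < b' → 0 < c' → a' < a → b' < b → c' < c → a ^ 2 - a' ^ 2 = b ^ 2 - b' ^ 2 → b ^ 2 - b' ^ 2 = c ^ 2 - c' ^ 2 → 1 < (p 0) ^ 2 / a ^ 2 + (p 1) ^ 2 / b ^ 2 + (p 2) ^ 2 / c ^ 2 → r.domain = {x | x 0 ^ 2 / (a : ℝ) ^ 2 + x 1 ^ 2 / (b : ℝ) ^ 2 + x 2 ^ 2 / (c : ℝ) ^ 2 < 1} → r'.domain = {x | x 0 ^ 2 / (a' : ℝ) ^ 2 + x 1 ^ 2 / (b' : ℝ) ^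 2 + x 2 ^ 2 / (c' : ℝ) ^ 2 < 1} → Set.EqOn r.integrand (fun x => (a' * b' * c' : ℝ) * (x j - p j) / Real.sqrt (∑ i, (x i - p i) ^ 2) ^ 3) r.domain → Set.EqOn r'.integrand (fun x => (a * b * c : ℝ) * (x j - p j) / Real.sqrt (∑ i, (x i - p i) ^ 2) ^ 3) r'.domain → Literature.NumberTheory.Transcendental.KZ.Equivalent r r'

/-- item stmt-KontsevichZagierPeriods-0540 · aside · rank 5 · open · by planner
why it might fail: A certificate for [π]⋆c may mix the disc coordinates with c's (carrier migration), leaving no shadow certificate for c; the motivic shadow P̃^eff→P̃ injective is printed OPEN (HuberWustholz2022 App A.4); one witness (Neg 11011 / 0542 shape) refutes it and S.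
sources: HuberWustholz2022, AyoubRelKZRevisited, KontsevichZagier2001, HuberMullerStachPeriods2017, Ayoub2014
PiCancellation := ∀ c : Literature.NumberTheory.Transcendental.KZ.FormalRep, (of piRep) ⋆ c ∈
Literature.NumberTheory.Transcendental.KZ.relations → c ∈
Literature.NumberTheory.Transcendental.KZ.relations, piRep = closed unit disc with integrand 1 (d =
2). A consequence of S (eval (piRep ⋆ c) = π · eval c by Fubini, π ≠ 0), but transcendence-free: it
is a regular-element property of the presented abelian group FormalRep/relations under the product,
and the exact point where Ayoub's relative theorem fails to be effective (AyoubRelKZRevisited Rem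
1.3: the torsor exists only over D((2πi)⁻¹)) and where HuberMullerStach2017 §13 passes from P^eff to
P = P^eff[(2πi)⁻¹]. Independent of the chosen π-representation once `relations` is an ideal under ⋆
(part of the def request). Attack suggestions: (i) normal forms for ⋆-multiples of disc reps (the
disc factor occupies two leading coordinates untouched by NL along the last coordinate; CoV may mix
them — the crux is whether a relation certificate for piRep ⋆ c can be 'projected' to one for c,
e.g. by restricting/fibrewise-specialising the disc coordinates at a rational point and using domain
additivity); (ii) small cases: c supported in dimensi -/
@[route_item "route-KontsevichZagierPeriods-VietaFibre"]
def AyoubPiCancellation : Prop :=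
  ∀ (P : ∀ n : ℕ, Literature.NumberTheory.Transcendental.KZ.IntegralRep n → Literature.NumberTheory.Transcendental.KZ.IntegralRep (n + 2)), (∀ (n : ℕ) (r : Literature.NumberTheory.Transcendental.KZ.IntegralRep n), (P n r).domain = {z : Fin (n + 2) → ℝ | z 0 ^ 2 + z 1 ^ 2 ≤ 1 ∧ (fun i : Fin n => z i.succ.succ) ∈ r.domain} ∧ (P n r).integrand = fun z => r.integrand (fun i : Fin n => z i.succ.succ)) → ∀ c : Literature.NumberTheory.Transcendental.KZ.FormalRep, FreeAbelianGroup.lift (fun s : (Σ n, Literature.NumberTheory.Transcendental.KZ.IntegralRep n) => Literature.NumberTheory.Transcendental.KZ.of (P s.1 s.2)) c ∈ Literature.NumberTheory.Transcendental.KZ.relations → c ∈ Literature.NumberTheory.Transcendental.KZ.relations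

/-- item stmt-KontsevichZagierPeriods-0541 · aside · rank 6 · open · by planner
why it might fail: GPC-strength after inverting [π] (Ayoub2014 Conj 7/Cor 32, HMS Prop 13.2.6): with 0540 it gives alg. independence of ζ(3), ζ(5), …; torsor methods give Nori-side relations only, their transfer into the four moves is unproved; one value-0 combination resisting every [π]-power refutes it and S.
sources: Ayoub2014, HuberMullerStachPeriods2017, AyoubRelKZRevisited, KontsevichZagier2001, arXiv:1105.0865
PiLocalKernel := ∀ c : Literature.NumberTheory.Transcendental.KZ.FormalRep,
Literature.NumberTheory.Transcendental.KZ.eval c = 0 → ∃ N : ℕ, (of piRep)^⋆N ⋆ c ∈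
Literature.NumberTheory.Transcendental.KZ.relations. This is the half of S reachable by torsor
arguments: Grothendieck's period conjecture gives injectivity of P̃ = P̃^eff[(2πi)⁻¹] → ℂ (route
Grothendieck, 0279), and a transfer of Nori/cohomological relators into KZ.relations (route
NoriTransfer, 0194/0198) then yields (2πi)^{2N}·c = (−4π²)^N·c ∈ relations WITHOUT needing
injectivity of P̃^eff → P̃; Ayoub's rigid-analytic computation of the Betti–de Rham torsor
(Ayoub2015 §3.6, AyoubRelKZRevisited Thm 1.11) is the model argument and works precisely after
inverting 2πi. Open (≈ GPC-strength); filed so that provers/refuters see the effective/localised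
distinction explicitly and so that a proof of #2′ collapses the problem to this item.
[needs_definition: KZ.prodRep / piRep / PiLocalKernel (def request this session); sources:
AyoubRelKZRevisited, Ayoub2015, HuberMullerStach2017] -/
@[route_item "route-KontsevichZagierPeriods-VietaFibre"]
def AyoubPiLocalKernel : Prop :=
  ∀ (P : ∀ n : ℕ, Literature.NumberTheory.Transcendental.KZ.IntegralRep n → Literature.NumberTheory.Transcendental.KZ.IntegralRep (n + 2)), (∀ (n : ℕ) (r : Literature.NumberTheory.Transcendental.KZ.IntegralRep n), (P n r).domain = {z : Fin (n + 2) → ℝ | z 0 ^ 2 + z 1 ^ 2 ≤ 1 ∧ (fun i : Fin n => z i.succ.succ) ∈ r.domain} ∧ (P n r).integrand = fun z => r.integrand (fun i : Fin n => z i.succ.succ)) → ∀ c : Literature.NumberTheory.Transcendental.KZ.FormalRep, Literature.NumberTheory.Transcendental.KZ.eval c = 0 → ∃ N : ℕ, (⇑(FreeAbelianGroup.lift (fun s : (Σ n, Literature.NumberTheory.Transcendental.KZ.IntegralRep n) => Literature.NumberTheory.Transcendental.KZ.of (P s.1 s.2))))^[N] c ∈ Literature.NumberTheory.Transcendental.K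Z.relations

/-- item stmt-KontsevichZagierPeriods-18038 · support · rank 9 · closed · proved by Summit.KontsevichZagierPeriods.KernelForm.Split.kernelFormPiSplitGlue_proof @ ee069725c6b3 (prover) · by planner
[support] GLUE of the crux-strategist's [π]-SPLIT of KernelForm (SUSPECT-EQUIVALENCE redirect
2026-08-17: `kernelForm_iff_summit` makes VietaFibre's deciding crux KernelForm the summit with NO
sibling used, so the node is RESTATED and is redirected — Kontsevich–Zagier 2001 §4.1 P̂ =
P[(2πi)⁻¹] read in both directions; Ayoub2014 Def. 6 / Conj. 7): AyoubPiLocalKernel (child 1 = item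
stmt-0541 verbatim) → AyoubPiCancellation (child 2 = item stmt-0540 verbatim) → KernelForm. PROVED
sorry-free against the tree — planner evidence VietaFibreKernelFormSplit.lean on stmt-10447
(Summit.KontsevichZagierPeriods.KernelForm.Split.KernelForm_of_subs: lean check rc 0, errors [], 0
sorry, axioms propext/Classical.choice/Quot.sound; one application of the LANDED item dictionary
kernelForm_iff_ayoubPiLocalKernel_and_ayoubPiCancellation,
Theorems/VietaFibreKernelFormItemDictionary.lean p121847: the pinned family exists, child 1 gives
(lift (of ∘ P))^[N] c ∈ KZ.relations for every c of value 0, child 2 peels the N factors by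
induction). Summits/Theorems is prover-only (perm.theorems-prover-only), so a prover lands that file
verbatim as Theorems/VietaFibreKernelFormSplit.lean and closes THIS item with t -/
@[route_item "route-KontsevichZagierPeriods-VietaFibre"]
def KernelFormPiSplitGlue : Prop :=
  (∀ (P : ∀ n : ℕ, Literature.NumberTheory.Transcendental.KZ.IntegralRep n → Literature.NumberTheory.Transcendental.KZ.IntegralRep (n + 2)), (∀ (n : ℕ) (r : Literature.NumberTheory.Transcendental.KZ.IntegralRep n), (P n r).domain = {z : Fin (n + 2) → ℝ | z 0 ^ 2 + z 1 ^ 2 ≤ 1 ∧ (fun i : Fin n => z i.succ.succ) ∈ r.domain} ∧ (P n r).integrand = fun z => r.integrand (fun i : Fin n => z i.succ.succ)) → ∀ c : Literature.NumberTheory.Transcendental.KZ.FormalRep, Literature.NumberTheory.Transcendental.KZ.eval c = 0 → ∃ N : ℕ, (⇑(FreeAbelianGroup.lift (fun s : (Σ n, Literature.NumberTheory.Transcendental.KZ.IntegralRep n) => Literature.NumberTheory.Transcendental.KZ.of (P s.1 s.2))))^[N] c ∈ Literature.NumberTheory.Transcendental.KZ.relations) → (∀ (P : ∀ n : ℕ,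 Literature.NumberTheory.Transcendental.KZ.IntegralRep n → Literature.NumberTheory.Transcendental.KZ.IntegralRep (n + 2)), (∀ (n : ℕ) (r : Literature.NumberTheory.Transcendental.KZ.IntegralRep n), (P n r).domain = {z : Fin (n + 2) → ℝ | z 0 ^ 2 + z 1 ^ 2 ≤ 1 ∧ (fun i : Fin n => z i.succ.succ) ∈ r.domain} ∧ (P n r).integrand = fun z => r.integrand (fun i : Fin n => z i.succ.succ)) → ∀ c : Literature.NumberTheory.Transcendental.KZ.FormalRep, FreeAbelianGroup.lift (fun s : (Σ n, Literature.NumberTheory.Transcendental.KZ.IntegralRep n) => Literature.NumberTheory.Transcendental.KZ.of (P s.1 s.2)) c ∈ Literature.NumberTheory.Transcendental.KZ.relations → c ∈ Literature.NumberTheory.Transcendental.KZ.relations) → KernelForm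

-- `KernelFormPiSplitGlue` holds: proved by `Summit.KontsevichZagierPeriods.KernelForm.Split.kernelFormPiSplitGlue_proof` @ ee069725c6b3 (its module imports this route file, so no `_holds` link can be stated here).

/-- item stmt-KontsevichZagierPeriods-5151 · support · rank 9 · open · by planner
sources: Kellogg1967, KontsevichZagierPeriods2001, Arnold1985HyperbolicLayers
[support] Newton's no-attraction theorem in the plane as a LITERAL instance of the summit between
two RATIONAL representations: for the elliptic ring c₁ ≤ Ax² + By² ≤ c₂ (A, B, c₁, c₂ ∈ ℚ₊) and a
rational point p inside the inner ellipse, the logarithmic-force integrals of the two halves {x₀ >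
p₀} (integrand (x_j − p_j)/|x − p|²) and {x₀ < p₀} (integrand −(x_j − p_j)/|x − p|²) are equal
(total force 0; ε ≡ +1 for d = 2) hence KZ-equivalent. d = 2 case of ArnoldForceVanishing: root
functions explicit by the quadratic formula (no CAD), Kellogg's equal-chords lemma; numerics
(A,B,c₁,c₂,p) = (1,2,1,4,(1/2,1/3)): halves = ±(1.88700, −0.07456). [difficulty: L] -/
@[route_item "route-KontsevichZagierPeriods-VietaFibre"]
def PlanarHomoeoid : Prop :=
  ∀ (A B c₁ c₂ : ℚ) (p : Fin 2 → ℚ) (j : Fin 2) (r r' : Literature.NumberTheory.Transcendental.KZ.IntegralRep 2), 0 < A → 0 < B → 0 < c₁ → c₁ < c₂ → A * (p 0) ^ 2 + B * (p 1) ^ 2 < c₁ → r.domain = {x | (c₁ : ℝ) ≤ A * x 0 ^ 2 + B * x 1 ^ 2 ∧ A * x 0 ^ 2 + B * x 1 ^ 2 ≤ (c₂ : ℝ) ∧ (p 0 : ℝ) < x 0} → r'.domain = {x | (c₁ : ℝ) ≤ A * x 0 ^ 2 + B * x 1 ^ 2 ∧ A * x 0 ^ 2 + B * x 1 ^ 2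 ≤ (c₂ : ℝ) ∧ x 0 < (p 0 : ℝ)} → Set.EqOn r.integrand (fun x => (x j - p j) / ((x 0 - p 0) ^ 2 + (x 1 - p 1) ^ 2)) r.domain → Set.EqOn r'.integrand (fun x => -(x j - p j) / ((x 0 - p 0) ^ 2 + (x 1 - p 1) ^ 2)) r'.domain → Literature.NumberTheory.Transcendental.KZ.Equivalent r r'

/-- item stmt-KontsevichZagierPeriods-5152 · support · rank 9 · open · by planner
sources: Ivory1809, Arnold1989, Kellogg1967
[support] Ivory's theorem (1809) at corresponding points, the ACCESSIBLE exterior case, four moves: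
E ⊃ E′ confocal rational solid ellipsoids, P rational on ∂E, P′ = (a′P₀/a, b′P₁/b, c′P₂/c) ∈ ∂E′;
then b′c′·[E, (x₀ − P′₀)/|x − P′|³] ~ bc·[E′, (x₀ − P₀)/|x − P|³] (values −2π·a′bc·b′c′·A₁·P₀ both;
checked). Chain: Newton–Leibniz along x₀ (primitive 1/|x − P′|, one null fibre through the interior
point P′ excised) → base rep on the disc D_E with integrand 1/|Q₊ − P′| − 1/|Q₋ − P′| (Q± the fibre
ends on ∂E) → Ivory's pointwise lemma |Q − ΦP| = |ΦQ − P| for P, Q ∈ ∂E (pure algebra, EqOn) →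
affine CoV (y,z) ↦ (b′y/b, c′z/c) onto D_{E′}, constant Jacobian b′c′/(bc) → Newton–Leibniz back up
along x₀ on E′ (P exterior to E′: primitive continuous). [difficulty: M] -/
@[route_item "route-KontsevichZagierPeriods-VietaFibre"]
def IvoryCorresponding : Prop :=
  ∀ (a b c a' b' c' : ℚ) (P : Fin 3 → ℚ) (r r' : Literature.NumberTheory.Transcendental.KZ.IntegralRep 3), 0 < a' → 0 < b' → 0 < c' → a' < a → b' < b → c' < c → a ^ 2 - a' ^ 2 = b ^ 2 - b' ^ 2 → b ^ 2 - b' ^ 2 = c ^ 2 - c' ^ 2 → (P 0) ^ 2 / a ^ 2 + (P 1) ^ 2 / b ^ 2 + (P 2) ^ 2 / c ^ 2 = 1 → r.domain = {x | x 0 ^ 2 / (a : ℝ) ^ 2 + x 1 ^ 2 / (b : ℝ) ^ 2 + x 2 ^ 2 / (c : ℝ) ^ 2 < 1} → r'.domain = {x | x 0 ^ 2 / (a' : ℝ) ^ 2 + x 1 ^ 2 / (b' : ℝ) ^ 2 + x 2 ^ 2 / (c' : ℝ) ^ 2 < 1} → Set.EqOn r.integrand (fun x => (b' * c' : ℝ)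 * (x 0 - a' * P 0 / a) / Real.sqrt ((x 0 - a' * P 0 / a) ^ 2 + (x 1 - b' * P 1 / b) ^ 2 + (x 2 - c' * P 2 / c) ^ 2) ^ 3) r.domain → Set.EqOn r'.integrand (fun x => (b * c : ℝ) * (x 0 - P 0) / Real.sqrt (∑ i, (x i - P i) ^ 2) ^ 3) r'.domain → Literature.NumberTheory.Transcendental.KZ.Equivalent r r'

/-- item stmt-KontsevichZagierPeriods-5153 · support · rank 9 · closed · proved by Summit.KontsevichZagierPeriods.VietaFibre.depolarisationSum_proof @ e69e2d96c9ad (prover) · by planner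
sources: Kellogg1967, KontsevichZagierPeriods2001
[support] card P1, the "Poisson move": for rational a, b, c > 0 the depolarisation factors A =
abc∫₀^∞ ds/((a²+s)Δ), B, C (Δ = √((a²+s)(b²+s)(c²+s)); incomplete elliptic integrals of the second
kind) satisfy A + B + C = 2, as KZ.Equivalent of the compactified (s = t/(1−t)) 1-dim algebraic rep
[(0,1), abc·√(1−t)/√R(t)·Σ_i 1/(a_i²(1−t)+t)], R(t) = Π_i(a_i²(1−t)+t), and the constant 2 (dim 0).
ONE newtonLeibnizRel (base = point, band [0,1], primitive Ψ(t) = −2abc(1−t)^{3/2}/√R(t), continuous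
on [0,1], Ψ(0) = −2, Ψ(1) = 0, Ψ′ = integrand on (0,1) — verified numerically at (1,2,3): A,B,C =
1.15309, 0.53431, 0.31260) plus dimension bookkeeping (KZ.slab / IntegralRep 0 conventions).
Cheapest rational-valued genus-1 calibration in the tree (Gauss's flux theorem read on the
ellipsoid; Kellogg1967 Ch. VII §6 Ex. 3). [difficulty: provable-now] -/
@[route_item "route-KontsevichZagierPeriods-VietaFibre"]
def DepolarisationSum : Prop :=
  ∀ (a b c : ℚ) (r : Literature.NumberTheory.Transcendental.KZ.IntegralRep 1) (r' : Literature.NumberTheory.Transcendental.KZ.IntegralRep 0), 0 < a → 0 < b → 0 < c → r.domain = {x | x 0 ∈ Set.Ioo (0 : ℝ) 1} → Set.EqOn r.integrand (fun x => (a * b * c : ℝ) * Real.sqrt (1 - x 0) / Real.sqrt ((a ^ 2 * (1 - x 0) + x 0) * (b ^ 2 * (1 - x 0) + x 0) * (c ^ 2 * (1 - x 0) + x 0)) * (1 / (a ^ 2 * (1 - x 0) + x 0) + 1 / (b ^ 2 * (1 - x 0) + x 0) + 1 / (c ^ 2 * (1 - x 0) + x 0))) r.domain → r'.domain = Set.univ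 → Set.EqOn r'.integrand (fun _ => 2) r'.domain → Literature.NumberTheory.Transcendental.KZ.Equivalent r r'

-- `DepolarisationSum` holds: proved by `Summit.KontsevichZagierPeriods.VietaFibre.depolarisationSum_proof` @ e69e2d96c9ad (its module imports this route file, so no `_holds` link can be stated here).

-- earlier Assembly (stmt-KontsevichZagierPeriods-0197, replaced 2026-08-15T16:17:20Z -> stmt-KontsevichZagierPeriods-10496): proved by Summit.KontsevichZagierPeriods.KernelForm.kernel_implies_statement — (∀ c : Literature.NumberTheory.Transcendental.KZ.FormalRep, Literature.NumberTheory.Transcendental.KZ.eval c = 0 → c ∈ Literature.NumberTheory.Transcendental.KZ.relations) → KontsevichZagierPeriods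
/-- item stmt-KontsevichZagierPeriods-10496 · assembly · rank 1 · closed · proved by Summit.KontsevichZagierPeriods.KernelForm.Split.assembly_proof (prover) · by planner
sources: KontsevichZagierPeriods2001, HuberMullerStachPeriods2017
[assembly] the kernel step over this route's own target: KernelForm (Conjecture 1 in kernel form,
stated inline) → KontsevichZagierPeriods. Provable now, 3 lines (r.value = r'.value ⇒ KZ.eval ([r] −
[r']) = 0 by map_sub/eval_of ⇒ [r] − [r'] ∈ KZ.relations = KZ.Equivalent r r'); the same argument is
already the body of the route's deciding theorem `closes`, which therefore does not take this item
as a hypothesis. Replaces, for this route only, the shared item stmt-KontsevichZagierPeriods-0197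
(`KZKernelConjecture → KontsevichZagierPeriods`, by-name reference to the Literature conjecture
leaf). The cruxes HyperbolicLayerRelator, ArnoldForceVanishing, MacLaurinExterior and the three
supports remain INSTANCES of KernelForm (sector route), not a decomposition of it. [difficulty:
provable-now] -/
@[route_item "route-KontsevichZagierPeriods-VietaFibre"]
def Assembly : Prop :=
  KernelForm → KontsevichZagierPeriods

-- `Assembly` holds: proved by `Summit.KontsevichZagierPeriods.KernelForm.Split.assembly_proof` (its module imports this route file, so no `_holds` link can be stated here).

/-! D-0027 §2.1 — DECIDING THEOREM (planner-authored via `route open/edit --closes-file`; by planner-rchoice-KontsevichZagierPeriods-VietaF-8f5ec10d-0 2026-08-16T22:27:17Z):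
its hypotheses are this route's items and its conclusion the sub-problem Statement (glue_lint), and it elaborates with this file. -/

@[closes "route-KontsevichZagierPeriods-VietaFibre"] theorem closes : KernelForm → HyperbolicLayerRelator → ArnoldForceVanishing → MacLaurinExterior → _root_.KontsevichZagierPeriods := by
  intro hK _ _ _ n m r r' _ _ hv
  apply hK
  simp [Literature.NumberTheory.Transcendental.KZ.eval_of, hv]

end Summit.KontsevichZagierPeriods.KontsevichZagierPeriods.Theses.VietaFibre
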